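import Summits.Ventures.PercRepro.C017Kernel
import Summits.Ventures.PercRepro.C026

/-!
# C-026 in the kernel: the class sum of `kernel26` as a bit-code computation (p5, gen 7)

typer-1's `C017Kernel.lean` makes the C-017 class sum a kernel computation (rows as `Fin 5` codes,
the kernel packed into 2-bit fields, the face `[⊥, u]` as the listed sub-masks of `u`, the check
`Check17` decided slice by slice).  This file is the same machinery for C-026's kernel
`kernel26 = [σ one pair] − [σ joins ab]·[τ isolates c]` (`C026.lean`), reusing typer-1's generic
layer (`rowOf3` / `row3D` / `rowInd3_eq` / `row3D_ext` / `rowTable3M` / `subSize` / `cfgOf_zero`):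

* `kernel26Z` — the integer kernel on rows; **`kernel26_eq`** — `kernel26` is `kernel26Z` of the two rows;
  `cubeSum26Z` and **`cubeSumQuad_kernel26_eq_cubeSum26Z`** — the class sum is the integer sum;
* `k26Packed` / `k26Entry` — `kernel26Z + 1 ∈ {0, 1, 2}` packed into 2-bit fields (`k26Entry_eq`);
* `faceSlack26Z` and **`cubeSum26Z_eq_faceSlack26Z_sub`** — a subgraph's class sum is a face slack of the
  supergraph; `subScore26` and `faceSlack26Z_eq_table` — the face slack read from the row table;
* **`Check26`** (the Boolean the kernel decides, `Σ_u 2^{|u|} = 3^k` points), `Range26` (its slices,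
  `range26_trans`, `check26_of_range26`) and **`faceSlack26Z_nonneg_of_check`** (the bridge back).

`C026K5.lean` decides `Check26` for `K₅` with marks `0, 1, 2`; `C026UpTo5.lean` assembles
`c026UpTo5 : C026UpTo 5`.
-/

namespace PercRepro

/-- **The integer kernel of C-026 on rows** (`kernel26` through the rows `abc = 0, ab|c = 1, ac|b = 2,
bc|a = 3, a|b|c = 4`): `[s one pair] − [s joins ab]·[t isolates c]`. -/
def kernel26Z (s t : Fin 5) : ℤ :=
  ((if s = 1 then 1 else 0) + (if s = 2 then 1 else 0) + (if s = 3 then 1 else 0)) -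
    ((if s = 0 then 1 else 0) + (if s = 1 then 1 else 0)) *
      ((if t = 1 then 1 else 0) + (if t = 4 then 1 else 0))

/-- `kernel26Z + 1 ∈ {0, 1, 2}` packed into 2-bit fields at the codes `s * 5 + t`. -/
def k26Packed : ℕ := 375666472556625

/-- The packed entry `kernel26Z(s, t) + 1` at a code `c = s * 5 + t`. -/
def k26Entry (c : ℕ) : ℕ := (k26Packed >>> (2 * c)) &&& 3

/-- The packed entry at the code of `(s, t)` is `kernel26Z(s, t) + 1` (`25` cases). -/
theorem k26Entry_eq (s t : Fin 5) : (k26Entry (s.val * 5 + t.val) : ℤ) = kernel26Z s t + 1 := by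
  revert s t
  decide +kernel

namespace MultiGraph

variable {V E : Type*} (G : MultiGraph V E) [DecidableEq V] [Fintype V] [Fintype E] [DecidableEq E]

omit [DecidableEq E] in
/-- **`kernel26` is the integer kernel of the two rows.** -/
theorem kernel26_eq (a b c : V) (ω ω' : Config E) :
    kernel26 (G.markedPartition ω ![a, b, c]) (G.markedPartition ω' ![a, b, c]) =
      (kernel26Z (G.row3D a b c ω) (G.row3D a b c ω') : ℝ) := by
  unfold kernel26 kernel26Z
  simp only [rowInd3_eq]
  push_cast
  rfl

/-- The integer class sum of `kernel26` on the full cube (ordered antipodal pairs). -/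
def cubeSum26Z (a b c : V) : ℤ :=
  ∑ ω : Config E, kernel26Z (G.row3D a b c ω) (G.row3D a b c ωᶜ)

/-- **The C-026 class sum is the integer sum.** -/
theorem cubeSumQuad_kernel26_eq_cubeSum26Z (a b c : V) :
    G.cubeSumQuad ![a, b, c] kernel26 = (G.cubeSum26Z a b c : ℝ) := by
  unfold cubeSumQuad cubeSum cubeSum26Z
  push_cast
  exact Finset.sum_congr rfl fun ω _ => G.kernel26_eq a b c ω ωᶜ

/-- The integer slack of `kernel26` on the face `[⊥, u]`: the full cube of the spanning subgraph with
edge set `u`, each point paired with its antipode in the face. -/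
def faceSlack26Z (a b c : V) (u : Config E) : ℤ :=
  ∑ ω ∈ Finset.univ.filter (fun ω : Config E => ω ≤ u),
    kernel26Z (G.row3D a b c ω) (G.row3D a b c (antipode u ⊥ ω))

end MultiGraph

/-! ### A subgraph's class sum is a face slack of the supergraph -/

namespace MultiGraph

variable {V E' : Type*} {k : ℕ} (G : MultiGraph V E') (H : MultiGraph V (Fin k))
  [DecidableEq V] [Fintype V] [Fintype E'] [DecidableEq E']

/-- **The full-cube class sum of a subgraph is the face slack `[⊥, u_ι]` of the supergraph.** -/
theorem cubeSum26Z_eq_faceSlack26Z_sub {ι : E' → Fin k} (h : G.SubOf H ι) (a b c : V) :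
    G.cubeSum26Z a b c = H.faceSlack26Z a b c (imageMask ι) := by
  unfold cubeSum26Z faceSlack26Z
  refine Finset.sum_nbij' (fun ρ => ext ι ρ) (fun ω => fun e => ω (ι e)) ?_ ?_ ?_ ?_ ?_
  · intro ρ _
    exact Finset.mem_filter.mpr ⟨Finset.mem_univ _, ext_le_imageMask ι ρ⟩
  · intro ω _
    exact Finset.mem_univ _
  · intro ρ _
    funext e
    exact ext_apply ι h.1 ρ e
  · intro ω hω
    exact eq_ext_of_le ι h.1 (Finset.mem_filter.mp hω).2
  · intro ρ _
    rw [← ext_compl ι h.1, G.row3D_ext H h, G.row3D_ext H h]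

end MultiGraph

/-! ### The face check on codes, for graphs on `Fin n` vertices and `Fin k` edges -/

namespace MultiGraph

variable {n k : ℕ} (G : MultiGraph (Fin n) (Fin k))

/-- The face score of `[⊥, u]` on codes: the packed entries `kernel26Z + 1` over the listed
sub-masks `d` of `u`, the antipode being `u ∧ ¬d`. -/
def subScore26 (k T u : ℕ) : ℕ :=
  ((subs u k).map fun d => k26Entry (rowAt T d * 5 + rowAt T (antipodeCode k u 0 d))).sum

/-- **The face slack `[⊥, u]` is score − size** read from the row table. -/
theorem faceSlack26Z_eq_table (a b c : Fin n) (u : Fin (2 ^ k)) :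
    G.faceSlack26Z a b c (cfgOf k u.val) =
      (subScore26 k (G.rowTable3M a b c) u.val : ℤ) - subSize k u.val := by
  unfold faceSlack26Z subScore26 subSize
  rw [Finset.sum_filter, ← sum_cfgOf, sum_subs, sum_subs]
  push_cast
  rw [← Finset.sum_sub_distrib]
  refine Finset.sum_congr rfl fun x _ => ?_
  rw [if_congr (subMask_iff x.isLt u.val).symm rfl rfl]
  split_ifs with h
  · have ha : antipodeCode k u.val 0 x.val < 2 ^ k :=
      antipodeCode_lt u.isLt (by positivity) x.val
    rw [rowAt_rowTable3M, show antipodeCode k u.val 0 x.val = (⟨_, ha⟩ : Fin (2 ^ k)).val from rfl,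
      rowAt_rowTable3M, row3M_eq, row3M_eq, cfgOf_antipodeCode, cfgOf_zero, k26Entry_eq]
    ring
  · simp

/-- **The kernel check**: the row table once, then every face `[⊥, u]` has score ≥ size
(`Σ_u 2^{|u|} = 3^k` points). -/
def Check26 (a b c : Fin n) : Bool :=
  withLitB (G.rowTable3M a b c) fun T =>
    decide (∀ u : Fin (2 ^ k), subSize k u.val ≤ subScore26 k T u.val)

/-- **From the kernel check to the face slacks**: `Check26 = true` gives `0 ≤ faceSlack26Z` on
every face `[⊥, u]`. -/
theorem faceSlack26Z_nonneg_of_check (a b c : Fin n) (h : G.Check26 a b c = true)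
    (u : Config (Fin k)) : 0 ≤ G.faceSlack26Z a b c u := by
  unfold Check26 at h
  rw [withLitB_eq, decide_eq_true_iff] at h
  obtain ⟨x, rfl⟩ := exists_cfgOf u
  rw [faceSlack26Z_eq_table]
  have hx := h x
  omega

/-- The check restricted to the joins `lo ≤ u < hi` (a slice of the kernel's work). -/
def Range26 (a b c : Fin n) (lo hi : ℕ) : Prop :=
  ∀ u : Fin (2 ^ k), lo ≤ u.val → u.val < hi →
    withLitB (G.rowTable3M a b c) (fun T => decide (subSize k u.val ≤ subScore26 k T u.val)) = true

/-- The slice is decidable. -/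
instance (a b c : Fin n) (lo hi : ℕ) : Decidable (G.Range26 a b c lo hi) := by
  unfold Range26; infer_instance

/-- Two adjacent slices chain. -/
theorem range26_trans (a b c : Fin n) {lo mid hi : ℕ} (h₁ : G.Range26 a b c lo mid)
    (h₂ : G.Range26 a b c mid hi) : G.Range26 a b c lo hi := by
  intro u hlo hhi
  by_cases h : u.val < mid
  · exact h₁ u hlo h
  · exact h₂ u (not_lt.mp h) hhi

/-- The full slice is the check. -/
theorem check26_of_range26 (a b c : Fin n) (h : G.Range26 a b c 0 (2 ^ k)) :
    G.Check26 a b c = true := by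
  unfold Check26
  rw [withLitB_eq, decide_eq_true_iff]
  intro u
  have := h u (Nat.zero_le _) u.isLt
  rw [withLitB_eq, decide_eq_true_iff] at this
  exact this

end MultiGraph

end PercRepro
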